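import Summits.ValiantsHypothesis.ValiantsHypothesis.Theorems.SymPencilPerFourBlocks

/-!
# Route `SymPencil` — equality case: `4`-dimensional spaces with vanishing `2 × 2` subpermanents are lines
# (`--supports` stmt-ValiantsHypothesis-5674 `SdcSuperquadratic`; the `r = 12` branch past `sdc(per_4) ≥ 25`)

`SymPencilPerFourBlocks.finrank_le_four_of_perm_two_blocks`: a linear space `W` of `4 × 4` matrices on
which all `2 × 2` subpermanents vanish has `dim W ≤ 4`.  Here the EQUALITY CASE
(`row_or_col_of_perm_two_blocks`, characteristic `≠ 2` via `CharZero`): if `dim W = 4` then `W` is the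
space of matrices supported on ONE ROW or on ONE COLUMN.  (Companion of
`AlperBogartVelascoBoxThreeEq.exists_line_of_subperm_two_vanish` for `3 × 3`.)

Use.  In the two-sided kernel package of a symmetric determinantal representation of `per_4` of size
`m ≥ 25` the case `r = 12` has `dim V = 4` and defect `0`, so `per_4` is affine along `V` at every base
point, all `2 × 2` subpermanents vanish on `V` (`perm_two_blocks_of_affine`), and by this file `V` is
a full row or a full column — the branch that no Hessian-rank count can exclude (crux note
NEXT-RUNG (G)).

Proof.  If some row `k` detects `W` (`x ∈ W`, `row_k x = 0 ⇒ x = 0`), then `row_k : W ≅ K⁴` and the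
pairings `x_{ij} x_{kl} + x_{il} x_{kj} = 0` evaluated on the sections `row_k x = e_l` and their sums
kill every other row (`λ + λ' = 0` thrice, `2 ≠ 0`).  Otherwise every row kernel `W ∩ ker row_k` is
non-zero; the flag count of the `≤ 4` proof then has profile `(1,1,1,1)`, the four level generators are
pairwise unpaired, hence multiples of a common `e_c` (three pairwise unpaired non-zero vectors of
`K⁴` share a single support), and the pairings inside single elements push every row into `K e_c`.
[folklore]
-/

noncomputable section

-- single-conjunct layout: Sub = Summit, duplicated namespace component intended
set_option linter.dupNamespace false

namespace Summit.ValiantsHypothesis.ValiantsHypothesis.Theorems.SymPencilPerFourBlocksEq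

open Module Finset
open Literature.Computability.AlgebraicComplexity
open Literature.Computability.AlgebraicComplexity.AlperBogartVelasco
open Summit.ValiantsHypothesis.ValiantsHypothesis.Theorems.SymPencilPerFourBlocks

variable {K : Type*} [Field K]

/-- Three pairwise "unpaired" non-zero vectors of `K⁴` (`p_k q_m + p_m q_k = 0` for `k ≠ m`) are
multiples of a common basis vector (characteristic `≠ 2`). [folklore] -/
theorem exists_common_support [CharZero K] {p q r : Fin 4 → K} (hp : p ≠ 0) (hq : q ≠ 0)
    (hr : r ≠ 0) (hpq : ∀ k m, k ≠ m → p k * q m + p m * q k = 0)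
    (hpr : ∀ k m, k ≠ m → p k * r m + p m * r k = 0)
    (hqr : ∀ k m, k ≠ m → q k * r m + q m * r k = 0) :
    ∃ c : Fin 4, ∀ m, m ≠ c → p m = 0 ∧ q m = 0 ∧ r m = 0 := by
  obtain ⟨c, hc⟩ : ∃ c, p c ≠ 0 := Function.ne_iff.1 hp
  have hq' : ∀ m, m ≠ c → p c * q m = -(p m * q c) := fun m hm => by
    linear_combination hpq c m (Ne.symm hm)
  have hr' : ∀ m, m ≠ c → p c * r m = -(p m * r c) := fun m hm => by
    linear_combination hpr c m (Ne.symm hm)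
  have hqc : q c ≠ 0 := by
    intro h0
    obtain ⟨m, hm⟩ := Function.ne_iff.1 hq
    by_cases hmc : m = c
    · rw [hmc] at hm; exact hm h0
    · have := hq' m hmc
      rw [h0, mul_zero, neg_zero] at this
      exact hm ((mul_eq_zero.1 this).resolve_left hc)
  have hrc : r c ≠ 0 := by
    intro h0
    obtain ⟨m, hm⟩ := Function.ne_iff.1 hr
    by_cases hmc : m = c
    · rw [hmc] at hm; exact hm h0
    · have := hr' m hmc
      rw [h0, mul_zero, neg_zero] at this
      exact hm ((mul_eq_zero.1 this).resolve_left hc)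
  have hp0 : ∀ m, m ≠ c → p m = 0 := by
    intro m hm
    have h3 := hqr c m (Ne.symm hm)
    have h2 : (2 : K) * (p c * p m * q c * r c) = 0 := by
      linear_combination (p c * r c) * hq' m hm + (p c * q c) * hr' m hm - (p c) ^ 2 * h3
    have h4 := (mul_eq_zero.1 h2).resolve_left two_ne_zero
    simp only [mul_eq_zero] at h4
    rcases h4 with ((h | h) | h) | h
    · exact absurd h hc
    · exact h
    · exact absurd h hqc
    · exact absurd h hrc
  refine ⟨c, fun m hm => ⟨hp0 m hm, ?_, ?_⟩⟩
  · have := hq' m hm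
    rw [hp0 m hm, zero_mul, neg_zero] at this
    exact (mul_eq_zero.1 this).resolve_left hc
  · have := hr' m hm
    rw [hp0 m hm, zero_mul, neg_zero] at this
    exact (mul_eq_zero.1 this).resolve_left hc

/-- **Equality case of `finrank_le_four_of_perm_two_blocks`**: a `4`-dimensional space of `4 × 4`
matrices on which all `2 × 2` subpermanents vanish is the space of matrices supported on one row,
or on one column (characteristic `0`). [folklore] -/
theorem row_or_col_of_perm_two_blocks [CharZero K] (W : Submodule K (Fin 4 × Fin 4 → K))
    (hB : ∀ y ∈ W, ∀ i k j l : Fin 4, i ≠ k → j ≠ l →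
      y (i, j) * y (k, l) + y (i, l) * y (k, j) = 0)
    (h4 : finrank K W = 4) :
    (∃ l : Fin 4, ∀ x ∈ W, ∀ i j : Fin 4, i ≠ l → x (i, j) = 0) ∨
    (∃ c : Fin 4, ∀ x ∈ W, ∀ i j : Fin 4, j ≠ c → x (i, j) = 0) := by
  classical
  have hcases : ∀ i : Fin 4, i = 0 ∨ i = 1 ∨ i = 2 ∨ i = 3 := by decide
  let ρ : Fin 4 → (Fin 4 × Fin 4 → K) →ₗ[K] (Fin 4 → K) :=
    fun r => LinearMap.funLeft K K fun j => (r, j)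
  have hρ : ∀ r x j, ρ r x j = x (r, j) := fun _ _ _ => rfl
  -- Case 1: some row `k` detects `W`
  by_cases hdet : ∃ k : Fin 4, ∀ x ∈ W, (∀ j, x (k, j) = 0) → x = 0
  · obtain ⟨k, hk⟩ := hdet
    left
    refine ⟨k, ?_⟩
    -- `row_k : W → K⁴` is injective, hence (dimension `4`) surjective: sections `xs l`
    have hsurj : ∀ t : Fin 4 → K, ∃ x ∈ W, ρ k x = t := by
      intro t
      let f : W →ₗ[K] (Fin 4 → K) := (ρ k).domRestrict W
      have hfinj : Function.Injective f := by
        refine LinearMap.ker_eq_bot.1 (LinearMap.ker_eq_bot'.2 fun x hx => ?_)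
        exact Subtype.ext (hk x x.2 fun j => by
          have := congr_fun hx j; exact this)
      have hrange : LinearMap.range f = ⊤ := by
        apply Submodule.eq_top_of_finrank_eq
        rw [LinearMap.finrank_range_of_inj hfinj, finrank_fintype_fun_eq_card, Fintype.card_fin,
          h4]
      have ht : t ∈ LinearMap.range f := by rw [hrange]; exact Submodule.mem_top
      obtain ⟨⟨x, hxW⟩, hx⟩ := ht
      exact ⟨x, hxW, hx⟩
    have hsec : ∀ l : Fin 4, ∃ x ∈ W, ρ k x = Pi.single l 1 := fun l => hsurj _
    choose xs hxsW hxsk using hsec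
    have hxs : ∀ l j, xs l (k, j) = if j = l then 1 else 0 := fun l j => by
      have := congr_fun (hxsk l) j
      rw [hρ] at this
      rw [this, Pi.single_apply]
    -- rows `i ≠ k` of the sections vanish
    have hoff : ∀ i, i ≠ k → ∀ l j, j ≠ l → xs l (i, j) = 0 := by
      intro i hik l j hjl
      have h := hB (xs l) (hxsW l) i k j l hik hjl
      rw [hxs, hxs, if_pos rfl, if_neg hjl, mul_one, mul_zero, add_zero] at h
      exact h
    have hdiag : ∀ i, i ≠ k → ∀ l l', l ≠ l' → xs l (i, l) + xs l' (i, l') = 0 := by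
      intro i hik l l' hll'
      have h := hB (xs l + xs l') (W.add_mem (hxsW l) (hxsW l')) i k l l' hik hll'
      simp only [Pi.add_apply, hxs, if_true, if_neg hll', if_neg hll'.symm,
        hoff i hik l l' hll'.symm, hoff i hik l' l hll', add_zero, zero_add, mul_one] at h
      linear_combination h
    have hsec0 : ∀ i, i ≠ k → ∀ l j, xs l (i, j) = 0 := by
      intro i hik l j
      by_cases hjl : j = l
      · subst hjl
        -- the diagonal entry: `λ_j + λ_{j'} = 0` for three other indices
        obtain ⟨a, b, hab, haj, hbj⟩ : ∃ a b : Fin 4, a ≠ b ∧ a ≠ j ∧ b ≠ j := by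
          have key : ∀ j : Fin 4, ∃ a b : Fin 4, a ≠ b ∧ a ≠ j ∧ b ≠ j := by decide
          exact key j
        have d1 := hdiag i hik j a (Ne.symm haj)
        have d2 := hdiag i hik j b (Ne.symm hbj)
        have d3 := hdiag i hik a b hab
        have h2 : (2 : K) * xs j (i, j) = 0 := by linear_combination d1 + d2 - d3
        exact (mul_eq_zero.1 h2).resolve_left two_ne_zero
      · exact hoff i hik l j hjl
    -- every `x ∈ W` is the combination of the sections with coefficients `x (k, ·)`
    intro x hx i j hik
    have hy : x - ∑ l, x (k, l) • xs l = 0 := by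
      apply hk _ (W.sub_mem hx (W.sum_mem fun l _ => W.smul_mem _ (hxsW l)))
      intro j'
      rw [Pi.sub_apply, Finset.sum_apply]
      simp only [Pi.smul_apply, smul_eq_mul, hxs, mul_ite, mul_one, mul_zero, Finset.sum_ite_eq,
        Finset.mem_univ, if_true, sub_self]
    have hx' : x = ∑ l, x (k, l) • xs l := sub_eq_zero.1 hy
    rw [hx', Finset.sum_apply]
    simp only [Pi.smul_apply, smul_eq_mul, hsec0 i hik, mul_zero, Finset.sum_const_zero]
  -- Case 2: no row detects `W`.  Run the flag of the `≤ 4` proof: all four levels are lines.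
  · push Not at hdet
    right
    let V₂ : Submodule K (Fin 4 × Fin 4 → K) := W ⊓ LinearMap.ker (ρ 3)
    let V₁ : Submodule K (Fin 4 × Fin 4 → K) := V₂ ⊓ LinearMap.ker (ρ 2)
    let V₀ : Submodule K (Fin 4 × Fin 4 → K) := V₁ ⊓ LinearMap.ker (ρ 1)
    let V : Fin 4 → Submodule K (Fin 4 × Fin 4 → K) := ![V₀, V₁, V₂, W]
    have hV0 : V 0 = V₀ := rfl; have hV1 : V 1 = V₁ := rfl
    have hV2 : V 2 = V₂ := rfl; have hV3 : V 3 = W := rfl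
    have memV : ∀ p, ∀ x ∈ V p, x ∈ W ∧ ∀ r, p < r → ∀ j, x (r, j) = 0 := by
      intro p x hx
      rcases hcases p with rfl | rfl | rfl | rfl
      · rw [hV0] at hx
        simp only [V₀, V₁, V₂, Submodule.mem_inf, LinearMap.mem_ker] at hx
        obtain ⟨⟨⟨hW', h3⟩, h2⟩, h1⟩ := hx
        refine ⟨hW', fun r hr j => ?_⟩
        rcases hcases r with rfl | rfl | rfl | rfl
        · exact absurd hr (by decide)
        · exact congr_fun h1 j
        · exact congr_fun h2 j
        · exact congr_fun h3 j
      · rw [hV1] at hx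
        simp only [V₁, V₂, Submodule.mem_inf, LinearMap.mem_ker] at hx
        obtain ⟨⟨hW', h3⟩, h2⟩ := hx
        refine ⟨hW', fun r hr j => ?_⟩
        rcases hcases r with rfl | rfl | rfl | rfl
        · exact absurd hr (by decide)
        · exact absurd hr (by decide)
        · exact congr_fun h2 j
        · exact congr_fun h3 j
      · rw [hV2] at hx
        simp only [V₂, Submodule.mem_inf, LinearMap.mem_ker] at hx
        obtain ⟨hW', h3⟩ := hx
        refine ⟨hW', fun r hr j => ?_⟩
        rcases hcases r with rfl | rfl | rfl | rfl
        · exact absurd hr (by decide)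
        · exact absurd hr (by decide)
        · exact absurd hr (by decide)
        · exact congr_fun h3 j
      · rw [hV3] at hx
        refine ⟨hx, fun r hr j => ?_⟩
        exact absurd (Fin.le_last r) (not_le.2 hr)
    have hbot : (V₀ ⊓ LinearMap.ker (ρ 0) : Submodule K _) = ⊥ := by
      rw [eq_bot_iff]
      intro x hx
      rw [Submodule.mem_inf, LinearMap.mem_ker] at hx
      obtain ⟨-, hrows⟩ := memV 0 x hx.1
      have h0 : ∀ j, x (0, j) = 0 := fun j => congr_fun hx.2 j
      rw [Submodule.mem_bot]
      funext ⟨i, j⟩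
      by_cases hi : i = 0
      · subst hi; exact h0 j
      · exact hrows i (by
          have : (0 : Fin 4) ≤ i := Fin.zero_le i
          exact lt_of_le_of_ne this (Ne.symm hi)) j
    have hdim : finrank K W = ∑ p, finrank K ((V p).map (ρ p)) := by
      rw [Fin.sum_univ_four, hV0, hV1, hV2, hV3,
        finrank_eq_finrank_map_add_finrank_inf_ker W (ρ 3),
        finrank_eq_finrank_map_add_finrank_inf_ker V₂ (ρ 2),
        finrank_eq_finrank_map_add_finrank_inf_ker V₁ (ρ 1),
        finrank_eq_finrank_map_add_finrank_inf_ker V₀ (ρ 0), hbot, finrank_bot]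
      ring
    have hpair : ∀ (p q : Fin 4) (x x' : Fin 4 × Fin 4 → K), x ∈ W → x' ∈ W →
        (∀ j, x (q, j) = 0) → ∀ j l, j ≠ l → p ≠ q →
        x (p, j) * x' (q, l) + x (p, l) * x' (q, j) = 0 := by
      intro p q x x' hx hx' hxq j l hjl hpq
      have h1 := hB (x + x') (W.add_mem hx hx') p q j l hpq hjl
      have h2 := hB x' hx' p q j l hpq hjl
      simp only [Pi.add_apply, hxq, zero_add] at h1
      linear_combination h1 - h2
    have hP : ∀ p q, p ≠ q → ∀ u ∈ (V p).map (ρ p), ∀ v ∈ (V q).map (ρ q),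
        ∀ j l, j ≠ l → u j * v l + u l * v j = 0 := by
      intro p q hpq u hu v hv j l hjl
      rw [Submodule.mem_map] at hu hv
      obtain ⟨x, hx, rfl⟩ := hu
      obtain ⟨x', hx', rfl⟩ := hv
      obtain ⟨hxW, hxr⟩ := memV p x hx
      obtain ⟨hx'W, hx'r⟩ := memV q x' hx'
      simp only [hρ]
      rcases lt_or_gt_of_ne hpq with hlt | hgt
      · exact hpair p q x x' hxW hx'W (hxr q hlt) j l hjl hpq
      · have h := hpair q p x' x hx'W hxW (hx'r p hgt) l j hjl.symm hpq.symm
        linear_combination h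
    have hle : ∀ i, finrank K ((V i).map (ρ i)) ≤ 4 := fun i =>
      (((V i).map (ρ i)).finrank_le).trans (by rw [finrank_fintype_fun_eq_card, Fintype.card_fin])
    have hPL : ∀ p q, p ≠ q → 1 ≤ finrank K ((V q).map (ρ q)) →
        finrank K ((V p).map (ρ p)) ≤ 1 := by
      intro p q hpq hq
      have hne : (V q).map (ρ q) ≠ ⊥ := fun h => by
        rw [h, finrank_bot] at hq; exact absurd hq (by decide)
      obtain ⟨v, hv, hv0⟩ := Submodule.exists_mem_ne_zero_of_ne_bot hne
      obtain ⟨c₀, hc₀⟩ : ∃ c₀, v c₀ ≠ 0 := Function.ne_iff.1 hv0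
      refine finrank_le_one_of_pairings _ v hc₀ fun u hu j hj => ?_
      exact hP p q hpq u hu v hv c₀ j (Ne.symm hj)
    have hsum : ∑ p, finrank K ((V p).map (ρ p)) = 4 := by rw [← hdim, h4]
    -- no level has dimension `≥ 2`: otherwise that row detects `W`
    have hone : ∀ p, finrank K ((V p).map (ρ p)) = 1 := by
      rw [Fin.sum_univ_four] at hsum
      by_contra hne
      push Not at hne
      -- some level `q` is `≠ 1`; then some level is `≥ 2`, hence `= 4` with the others `0`
      have hex : ∃ q, 2 ≤ finrank K ((V q).map (ρ q)) := by
        by_contra hno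
        push Not at hno
        obtain ⟨p, hp⟩ := hne
        have := hno 0; have := hno 1; have := hno 2; have := hno 3
        have a := hle 0
        rcases hcases p with rfl | rfl | rfl | rfl <;> omega
      obtain ⟨q, hq2⟩ := hex
      have hzero : ∀ p, p ≠ q → finrank K ((V p).map (ρ p)) = 0 := by
        intro p hpq
        by_contra hp0
        have hp1 : 1 ≤ finrank K ((V p).map (ρ p)) := Nat.one_le_iff_ne_zero.2 hp0
        have := hPL q p (Ne.symm hpq) hp1
        omega
      -- row `q` detects `W`: contradiction with `hdet q`
      obtain ⟨x, hxW, hxq, hx0⟩ := hdet q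
      apply hx0
      have hYbot : ∀ p, p ≠ q → (V p).map (ρ p) = ⊥ := fun p hpq =>
        Submodule.finrank_eq_zero.1 (hzero p hpq)
      have step : ∀ (k : Fin 4), x ∈ V k → ∀ j, x (k, j) = 0 := by
        intro k hxk j
        by_cases hkq : k = q
        · rw [hkq]; exact hxq j
        · have hm : ρ k x ∈ (V k).map (ρ k) := Submodule.mem_map_of_mem hxk
          rw [hYbot k hkq, Submodule.mem_bot] at hm
          exact congr_fun hm j
      have h3 := step 3 (by rw [hV3]; exact hxW)
      have hx2 : x ∈ V 2 := by
        rw [hV2]; simp only [V₂, Submodule.mem_inf, LinearMap.mem_ker]; exact ⟨hxW, funext h3⟩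
      have h2 := step 2 hx2
      have hx1 : x ∈ V 1 := by
        rw [hV1]; simp only [V₁, Submodule.mem_inf, LinearMap.mem_ker]
        rw [hV2] at hx2; exact ⟨hx2, funext h2⟩
      have h1 := step 1 hx1
      have hx0' : x ∈ V 0 := by
        rw [hV0]; simp only [V₀, Submodule.mem_inf, LinearMap.mem_ker]
        rw [hV1] at hx1; exact ⟨hx1, funext h1⟩
      have h0 := step 0 hx0'
      funext ⟨i, j⟩
      rcases hcases i with rfl | rfl | rfl | rfl <;> [exact h0 j; exact h1 j; exact h2 j; exact h3 j]
    -- generators of the four lines, with preimages in the flag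
    have hgen : ∀ p, ∃ x ∈ V p, ρ p x ≠ 0 ∧ (V p).map (ρ p) = K ∙ (ρ p x) := by
      intro p
      have hne : (V p).map (ρ p) ≠ ⊥ := fun h => by
        have := hone p; rw [h, finrank_bot] at this; exact absurd this (by decide)
      obtain ⟨u, hu, hu0⟩ := Submodule.exists_mem_ne_zero_of_ne_bot hne
      obtain ⟨x, hx, rfl⟩ := Submodule.mem_map.1 hu
      refine ⟨x, hx, hu0, ?_⟩
      refine (Submodule.eq_of_le_of_finrank_eq ?_ ?_).symm
      · exact (Submodule.span_singleton_le_iff_mem _ _).2 hu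
      · rw [finrank_span_singleton hu0, hone p]
    choose xs hxsV hxs0 hxspan using hgen
    -- the four generators `row_p (xs p)` are pairwise unpaired, hence share one column `c`
    have hunp : ∀ p q, p ≠ q → ∀ j l, j ≠ l →
        xs p (p, j) * xs q (q, l) + xs p (p, l) * xs q (q, j) = 0 := by
      intro p q hpq j l hjl
      have h := hP p q hpq (ρ p (xs p)) (Submodule.mem_map_of_mem (hxsV p)) (ρ q (xs q))
        (Submodule.mem_map_of_mem (hxsV q)) j l hjl
      simpa only [hρ] using h
    have hne : ∀ p, (fun j => xs p (p, j)) ≠ 0 := fun p h => hxs0 p (by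
      funext j; rw [hρ]; exact congr_fun h j)
    obtain ⟨c, hc⟩ := exists_common_support (hne 1) (hne 2) (hne 3)
      (fun k m hkm => hunp 1 2 (by decide) k m hkm) (fun k m hkm => hunp 1 3 (by decide) k m hkm)
      (fun k m hkm => hunp 2 3 (by decide) k m hkm)
    -- every generator has its own row inside `K e_c`
    have hrow : ∀ p m, m ≠ c → xs p (p, m) = 0 := by
      intro p m hm
      rcases hcases p with rfl | rfl | rfl | rfl
      · -- row `0` from its pairing with row `1`
        have hc1 : xs 1 (1, c) ≠ 0 := by
          intro h0
          apply hne 1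
          funext j
          by_cases hj : j = c
          · rw [hj]; exact h0
          · exact (hc j hj).1
        have h := hunp 0 1 (by decide) m c hm
        rw [(hc m hm).1, mul_zero, add_zero] at h
        exact (mul_eq_zero.1 h).resolve_right hc1
      · exact (hc m hm).1
      · exact (hc m hm).2.1
      · exact (hc m hm).2.2
    have hcne : ∀ p, xs p (p, c) ≠ 0 := by
      intro p h0
      apply hne p
      funext j
      by_cases hj : j = c
      · rw [hj]; exact h0
      · exact hrow p j hj
    -- every generator is supported in column `c`
    have hcol : ∀ p i m, m ≠ c → xs p (i, m) = 0 := by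
      intro p i m hm
      obtain ⟨hxW, hxr⟩ := memV p (xs p) (hxsV p)
      by_cases hip : i = p
      · rw [hip]; exact hrow p m hm
      rcases lt_or_gt_of_ne hip with hlt | hgt
      · have h := hB (xs p) hxW i p m c hip hm
        rw [hrow p m hm, mul_zero, add_zero] at h
        exact (mul_eq_zero.1 h).resolve_right (hcne p)
      · exact hxr i hgt m
    -- descending decomposition of an arbitrary `x ∈ W` along the generators
    have hdesc : ∀ p, ∀ x ∈ V p, ∃ a : K, x - a • xs p ∈ V p ⊓ LinearMap.ker (ρ p) := by
      intro p x hx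
      have hm : ρ p x ∈ (V p).map (ρ p) := Submodule.mem_map_of_mem hx
      rw [hxspan p, Submodule.mem_span_singleton] at hm
      obtain ⟨a, ha⟩ := hm
      refine ⟨a, ?_⟩
      rw [Submodule.mem_inf, LinearMap.mem_ker, map_sub, map_smul, ← ha, sub_self]
      exact ⟨(V p).sub_mem hx ((V p).smul_mem _ (hxsV p)), rfl⟩
    refine ⟨c, fun x hx i j hj => ?_⟩
    obtain ⟨a3, h3⟩ := hdesc 3 x (by rw [hV3]; exact hx)
    have hx2 : x - a3 • xs 3 ∈ V 2 := by rw [hV2]; rw [hV3] at h3; exact h3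
    obtain ⟨a2, h2⟩ := hdesc 2 _ hx2
    have hx1 : x - a3 • xs 3 - a2 • xs 2 ∈ V 1 := by rw [hV1]; rw [hV2] at h2; exact h2
    obtain ⟨a1, h1⟩ := hdesc 1 _ hx1
    have hx0' : x - a3 • xs 3 - a2 • xs 2 - a1 • xs 1 ∈ V 0 := by rw [hV0]; rw [hV1] at h1; exact h1
    obtain ⟨a0, h0⟩ := hdesc 0 _ hx0'
    rw [hV0, hbot, Submodule.mem_bot] at h0
    have hxeq : x = a0 • xs 0 + a1 • xs 1 + a2 • xs 2 + a3 • xs 3 := by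
      have := sub_eq_zero.1 h0
      linear_combination this
    rw [hxeq]
    simp only [Pi.add_apply, Pi.smul_apply, smul_eq_mul, hcol _ i j hj, mul_zero, add_zero]

end Summit.ValiantsHypothesis.ValiantsHypothesis.Theorems.SymPencilPerFourBlocksEq

end
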